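import Literature.AlgebraicGeometry.Resolution.WeightedCentreLemmaL
import Literature.AlgebraicGeometry.Resolution.WeightedCentreDerivationLayers
import Literature.AlgebraicGeometry.Resolution.WeightedCentreConstantField
import Mathlib.Algebra.MvPolynomial.PDeriv
import HarnessLib

/-!
# Filtered derivations: a derivation whose data weigh `≥ wt + δ` raises weights by `δ`; its LEADING derivation computes the lowest
# components of all iterates (engine 1's `W(f)` toy model, RE-DERIVATION-eng1-g44 §3.2 L9 (i) — an instrument, NOT a resolution theorem)

RE-DERIVATION-eng1-g44 §3.2, L9 ((L1′) toolkit, [R43] 3.11) (i): "for a triangular `𝔇` killing the variables of `Z″`, `λ` weights on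
`Z″`, `μ :=` the minimal `λ`-weight of the data monomials: every monomial of `𝔇^b(x)` has `λ`-weight `≥ bμ` and the part of `λ`-weight
exactly `bμ` is `𝔇_λ^b(x)` (`𝔇_λ :=` the derivation with data the weight-`μ` parts of the data of `𝔇`)".  This file is the general
graded-algebra statement behind it, for an arbitrary weight `wt : σ → M` into a linearly ordered abelian group and an arbitrary
derivation `D` of `K[ε_σ]` (`σ` finite) whose data satisfy `WtGE wt (wt i + δ) (D ε_i)` ("`D` has filtered degree `≥ δ`"; in the
engine's use `wt = λ` on `Z″` and `0` elsewhere, `δ = μ`, and the hypothesis holds because `D` kills `ε_{Z″}`):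
* `wtGE_pderiv` : `∂_i` lowers the weight filtration by `wt i`; `wtGE_apply` / `wtGT_apply` : `D` raises it by (at least / more than) `δ`
  when its data weigh `≥` / `>` `wt i + δ` (chain rule `D G = Σ_i ∂_i G · D ε_i`, `WeightedBlowup.derivation_apply_eq_sum_pderiv_mul`);
* `lead wt D δ := Σ_i comp_{wt i + δ}(D ε_i) ∂_i` — the LEADING DERIVATION (`𝔇_λ`), exactly graded of degree `+δ`
  (`isGradedCoeff_lead`), and `D = lead + tail` with `tail` of filtered degree `> δ` (`eq_lead_add_tail`, `wtGT_tail_apply`);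
* **`weightedHomogeneousComponent_apply`** : `comp_{n+δ}(D G) = lead (comp_n G)` whenever `G` weighs `≥ n`;
* **`iterate`** / **`weightedHomogeneousComponent_iterate_X`** (= L9 (i)) : `D^b G` weighs `≥ n + bδ` and
  `comp_{n+bδ}(D^b G) = lead^b (comp_n G)`; in particular `comp_{wt i + bδ}(D^b ε_i) = lead^b(ε_i)` for every slot and every `b`.
If `δ` is smaller than the true minimal shift, `lead = 0` and the statements hold trivially; no nilpotency, characteristic or
positivity hypothesis is used.

HONEST FRAMING.  Graded commutative algebra over a commutative ring ([Matsumura1987, §25] derivations of polynomial rings; [Lang2002,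
Ch. IV §1] weighted gradings; statements OURS in this packaging); an instrument for engine 1's `W(f)` TOY MODEL (the (L1′) step of the
engine's THEOREM 𝔉′, which is NOT proved here).  NOT a resolution theorem and NOT a statement about the invariant of [ATW2024].
-/

namespace Literature.AlgebraicGeometry.Resolution.WeightedBlowup

namespace FilteredDerivation

open MvPolynomial LeadingForm

variable {K : Type*} [CommRing K] {σ : Type*} [DecidableEq σ] {M : Type*} [AddCommGroup M] [LinearOrder M] [IsOrderedAddMonoid M]
  (wt : σ → M)

/-! ## Weight bounds for sums, partial derivatives and derivations -/

omit [DecidableEq σ] [IsOrderedAddMonoid M] in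
/-- A finite sum of polynomials weighing `≥ n` weighs `≥ n` (bookkeeping). [cite: Lang2002, Ch. IV §1] -/
theorem wtGE_sum {ι : Type*} (s : Finset ι) (F : ι → MvPolynomial σ K) {n : M} (h : ∀ i ∈ s, WtGE wt n (F i)) :
    WtGE wt n (∑ i ∈ s, F i) := by
  classical
  induction s using Finset.induction_on with
  | empty => rw [Finset.sum_empty]; exact wtGE_zero n
  | insert a s ha ih =>
    rw [Finset.sum_insert ha]
    exact (h a (Finset.mem_insert_self a s)).add (ih fun i hi => h i (Finset.mem_insert_of_mem hi))

omit [DecidableEq σ] in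
/-- `∂_i` lowers the weight filtration by `wt i`: `G` weighs `≥ n ⟹ ∂_i G` weighs `≥ n - wt i` (derived here).
[cite: Matsumura1987, §25] -/
theorem wtGE_pderiv {n : M} {G : MvPolynomial σ K} (hG : WtGE wt n G) (i : σ) : WtGE wt (n - wt i) (pderiv i G) := by
  intro d hd
  rw [mem_support_iff, coeff_pderiv] at hd
  have h1 : coeff (d + Finsupp.single i 1) G ≠ 0 := fun h => hd (by rw [h, zero_mul])
  have h2 := hG _ (mem_support_iff.mpr h1)
  rw [map_add, DerivationLayers.weight_single_one] at h2
  exact sub_le_iff_le_add.mpr h2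

variable [Fintype σ] (D : Derivation K (MvPolynomial σ K) (MvPolynomial σ K))

/-- **A derivation whose data weigh `≥ wt i + δ` raises the weight filtration by `δ`**: `G` weighs `≥ n ⟹ D G` weighs `≥ n + δ`
(derived here, chain rule). [cite: Matsumura1987, §25] -/
theorem wtGE_apply {δ : M} (hD : ∀ i, WtGE wt (wt i + δ) (D (X i))) {n : M} {G : MvPolynomial σ K} (hG : WtGE wt n G) :
    WtGE wt (n + δ) (D G) := by
  rw [derivation_apply_eq_sum_pderiv_mul D G]
  refine wtGE_sum wt _ _ fun i _ => ?_
  have h := (wtGE_pderiv wt hG i).mul (hD i)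
  rwa [show n - wt i + (wt i + δ) = n + δ by abel] at h

/-- Strict version: data weighing `> wt i + δ` give `D G` weighing `> n + δ` (derived here). [cite: Matsumura1987, §25] -/
theorem wtGT_apply {δ : M} (hD : ∀ i, WtGT wt (wt i + δ) (D (X i))) {n : M} {G : MvPolynomial σ K} (hG : WtGE wt n G) :
    WtGT wt (n + δ) (D G) := by
  rw [derivation_apply_eq_sum_pderiv_mul D G]
  refine WtGT.sum _ _ fun i _ => ?_
  have h := (wtGE_pderiv wt hG i).mul_wtGT (hD i)
  rwa [show n - wt i + (wt i + δ) = n + δ by abel] at h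

/-! ## The leading derivation -/

variable (δ : M)

/-- The LEADING DERIVATION of filtered degree `δ`: `lead wt D δ := Σ_i comp_{wt i + δ}(D ε_i) · ∂_i` (the engine's `𝔇_λ`; this file).
[cite: Matsumura1987, §25] -/
noncomputable def lead : Derivation K (MvPolynomial σ K) (MvPolynomial σ K) :=
  mkDerivation K fun i => weightedHomogeneousComponent wt (wt i + δ) (D (X i))

/-- The TAIL `D - lead` as the derivation with data `D ε_i - comp_{wt i + δ}(D ε_i)` (this file). [cite: Matsumura1987, §25] -/
noncomputable def tail : Derivation K (MvPolynomial σ K) (MvPolynomial σ K) :=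
  mkDerivation K fun i => D (X i) - weightedHomogeneousComponent wt (wt i + δ) (D (X i))

omit [DecidableEq σ] [LinearOrder M] [IsOrderedAddMonoid M] [Fintype σ] in
/-- `lead(ε_i) = comp_{wt i + δ}(D ε_i)` (definitional). [cite: Matsumura1987, §25] -/
theorem lead_X (i : σ) : lead wt D δ (X i) = weightedHomogeneousComponent wt (wt i + δ) (D (X i)) :=
  mkDerivation_X _ _ _

omit [DecidableEq σ] [LinearOrder M] [IsOrderedAddMonoid M] [Fintype σ] in
/-- `tail(ε_i) = D ε_i - comp_{wt i + δ}(D ε_i)` (definitional). [cite: Matsumura1987, §25] -/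
theorem tail_X (i : σ) : tail wt D δ (X i) = D (X i) - weightedHomogeneousComponent wt (wt i + δ) (D (X i)) :=
  mkDerivation_X _ _ _

omit [DecidableEq σ] [LinearOrder M] [IsOrderedAddMonoid M] [Fintype σ] in
/-- The leading data form a graded family of degree `+δ` (`IsGradedCoeff wt (-δ)`): `lead` is EXACTLY graded (derived here).
[cite: AbramovichTemkinWlodarczyk2024, §5] -/
theorem isGradedCoeff_lead :
    DerivationLayers.IsGradedCoeff wt (-δ) fun i => weightedHomogeneousComponent wt (wt i + δ) (D (X i)) :=
  fun i _ => ⟨wt i + δ, weightedHomogeneousComponent_isWeightedHomogeneous _ _, by rw [add_neg_cancel_right]⟩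

omit [DecidableEq σ] [LinearOrder M] [IsOrderedAddMonoid M] [Fintype σ] in
/-- `D = lead + tail` (derived here). [cite: Matsumura1987, §25] -/
theorem eq_lead_add_tail : D = lead wt D δ + tail wt D δ :=
  derivation_ext fun i => by rw [Derivation.add_apply, lead_X, tail_X, add_sub_cancel]

omit [DecidableEq σ] [LinearOrder M] [IsOrderedAddMonoid M] [Fintype σ] in
/-- `D G = lead G + tail G` (derived here). [cite: Matsumura1987, §25] -/
theorem apply_eq_lead_add_tail (G : MvPolynomial σ K) : D G = lead wt D δ G + tail wt D δ G := by
  rw [← Derivation.add_apply, ← eq_lead_add_tail]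

omit [DecidableEq σ] [LinearOrder M] [IsOrderedAddMonoid M] [Fintype σ] in
/-- `lead` shifts homogeneous components by `δ`: `comp_m (lead G) = lead (comp_{m - δ} G)` (derived here, from
`DerivationLayers.weightedHomogeneousComponent_mkDerivation`). [cite: AbramovichTemkinWlodarczyk2024, §5] -/
theorem weightedHomogeneousComponent_lead (G : MvPolynomial σ K) (m : M) :
    weightedHomogeneousComponent wt m (lead wt D δ G) = lead wt D δ (weightedHomogeneousComponent wt (m + -δ) G) :=
  DerivationLayers.weightedHomogeneousComponent_mkDerivation (isGradedCoeff_lead wt D δ) G m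

/-- `lead` raises the weight filtration by `δ` (derived here). [cite: Matsumura1987, §25] -/
theorem wtGE_lead_apply {n : M} {G : MvPolynomial σ K} (hG : WtGE wt n G) : WtGE wt (n + δ) (lead wt D δ G) :=
  wtGE_apply wt _ (fun i => by
    rw [lead_X]; exact wtGE_of_isWeightedHomogeneous (weightedHomogeneousComponent_isWeightedHomogeneous _ _)) hG

/-- When the data of `D` weigh `≥ wt i + δ`, the tail raises the filtration by MORE than `δ` (derived here).
[cite: Lang2002, Ch. IV §1] -/
theorem wtGT_tail_apply (hD : ∀ i, WtGE wt (wt i + δ) (D (X i))) {n : M} {G : MvPolynomial σ K} (hG : WtGE wt n G) :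
    WtGT wt (n + δ) (tail wt D δ G) :=
  wtGT_apply wt _ (fun i => by rw [tail_X]; exact LemmaL.wtGT_sub_weightedHomogeneousComponent (hD i)) hG

/-! ## The lowest components of `D G` and of the iterates `D^b G` -/

/-- **`comp_{n+δ}(D G) = lead (comp_n G)`** for `G` weighing `≥ n`, when the data of `D` weigh `≥ wt i + δ` (derived here).
[cite: Matsumura1987, §25] [cite: Lang2002, Ch. IV §1] -/
theorem weightedHomogeneousComponent_apply (hD : ∀ i, WtGE wt (wt i + δ) (D (X i))) {n : M} {G : MvPolynomial σ K}
    (hG : WtGE wt n G) :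
    weightedHomogeneousComponent wt (n + δ) (D G) = lead wt D δ (weightedHomogeneousComponent wt n G) := by
  rw [apply_eq_lead_add_tail wt D δ G, map_add, weightedHomogeneousComponent_lead, add_neg_cancel_right,
    weightedHomogeneousComponent_eq_zero' (n + δ) _ (fun d hd => (wtGT_tail_apply wt D δ hD hG d hd).ne'), add_zero]

/-- **L9 (i), general form**: for `G` weighing `≥ n` and data weighing `≥ wt i + δ`, every iterate `D^b G` weighs `≥ n + b•δ` and its
component of weight exactly `n + b•δ` is `lead^b (comp_n G)` (derived here). [cite: Matsumura1987, §25] [cite: Lang2002, Ch. IV §1] -/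
theorem iterate (hD : ∀ i, WtGE wt (wt i + δ) (D (X i))) {n : M} {G : MvPolynomial σ K} (hG : WtGE wt n G) (b : ℕ) :
    WtGE wt (n + b • δ) (D^[b] G) ∧
      weightedHomogeneousComponent wt (n + b • δ) (D^[b] G) = (lead wt D δ)^[b] (weightedHomogeneousComponent wt n G) := by
  induction b with
  | zero => exact ⟨by simpa using hG, by simp⟩
  | succ b ih =>
    rw [Function.iterate_succ_apply', Function.iterate_succ_apply', succ_nsmul, ← add_assoc]
    exact ⟨wtGE_apply wt D hD ih.1, by rw [weightedHomogeneousComponent_apply wt D δ hD ih.1, ih.2]⟩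

/-- **L9 (i) on a slot**: every monomial of `D^b ε_i` weighs `≥ wt i + b•δ` (derived here). [cite: Matsumura1987, §25] -/
theorem wtGE_iterate_X (hD : ∀ i, WtGE wt (wt i + δ) (D (X i))) (i : σ) (b : ℕ) : WtGE wt (wt i + b • δ) (D^[b] (X i)) :=
  (iterate wt D δ hD (wtGE_of_isWeightedHomogeneous (isWeightedHomogeneous_X K wt i)) b).1

/-- **L9 (i) on a slot**: the part of `D^b ε_i` of weight exactly `wt i + b•δ` is `lead^b ε_i` — "the part of `λ`-weight `bμ` of
`𝔇^b(x)` is `𝔇_λ^b(x)`" (derived here). [cite: Matsumura1987, §25] [cite: Lang2002, Ch. IV §1] -/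
theorem weightedHomogeneousComponent_iterate_X (hD : ∀ i, WtGE wt (wt i + δ) (D (X i))) (i : σ) (b : ℕ) :
    weightedHomogeneousComponent wt (wt i + b • δ) (D^[b] (X i)) = (lead wt D δ)^[b] (X i) := by
  have h := (iterate wt D δ hD (wtGE_of_isWeightedHomogeneous (isWeightedHomogeneous_X K wt i)) b).2
  rwa [(isWeightedHomogeneous_X K wt i).weightedHomogeneousComponent_same] at h

/-- Below the leading weight nothing survives: `comp_m (D^b ε_i) = 0` for `m < wt i + b•δ` (derived here). [cite: Lang2002, Ch. IV §1] -/
theorem weightedHomogeneousComponent_iterate_X_eq_zero (hD : ∀ i, WtGE wt (wt i + δ) (D (X i))) (i : σ) (b : ℕ) {m : M}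
    (hm : m < wt i + b • δ) : weightedHomogeneousComponent wt m (D^[b] (X i)) = 0 :=
  weightedHomogeneousComponent_eq_zero' m _ fun d hd => (lt_of_lt_of_le hm (wtGE_iterate_X wt D δ hD i b d hd)).ne'

end FilteredDerivation

end Literature.AlgebraicGeometry.Resolution.WeightedBlowup
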